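import Literature.Analysis.SpecialFunctions.JacobiThetaEtaQuotient
import HarnessLib

/-!
# The integer `q`-series of `ϑ₄(2tτ) = Σ_{n ∈ ℤ} (−1)ⁿ q^{t n²}` on the upper half-plane
(route `ManinLocalTwoThree`, crux C2 `ManinOddAtFour` stmt-BirchSwinnertonDyer-22967; cell bsd-f2-manin, prover p3 gen 19; input of the anchor forms
`ϑ₄(2τ)³ϑ₄(2tτ)` of the kernel port of E-an-152d: they have INTEGER, hence `Aut ℂ`-invariant, Fourier coefficients)

* `exists_hasSum_theta4_two_mul` — there is `c : ℕ → ℤ` with `Σₘ cₘ 𝕢τᵐ = ϑ₄(2tτ)` for every `τ ∈ ℍ` (`t ≥ 1`), namely `c₀ = 1`, `c_{tn²} = 2(−1)ⁿ`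
  (`n ≥ 1`), all other `cₘ = 0` (Mathlib's `hasSum_jacobiTheta₂_term`, folded over `±n` and re-indexed along the injection `n ↦ t n²`).
HONEST FRAMING: elementary bookkeeping about theta series; nothing about Manin constants, C2 or BSD is proved here.  No definitions, no sorry.
[cite: WhittakerWatson1927, §21.1]
-/

set_option autoImplicit false
-- lint-debt: the directory name repeats the summit name (sibling precedent `ManinLocalTwoThreeCDivisionGaloisEngine.lean`)
set_option linter.dupNamespace false

noncomputable section

open Complex Real Filter Topology
open UpperHalfPlane hiding I
open scoped Real
open Literature.NumberTheory.EllipticCurves.JacobiThetaNull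

namespace Summit.BirchSwinnertonDyer.BirchSwinnertonDyer.Theorems.ManinLocalTwoThree.EtaAnchor

/-- The theta term at `z = 1/2`, `τ ↦ 2tτ`: `(−1)ⁿ q^{t n²}` with `q = e^{2πiτ}`. [folklore] -/
theorem jacobiTheta₂_term_half_two_mul (n : ℤ) (t : ℕ) (τ : ℂ) :
    jacobiTheta₂_term n (1 / 2) (2 * (t : ℂ) * τ) = (-1 : ℂ) ^ n * Function.Periodic.qParam 1 τ ^ (t * n.natAbs ^ 2) := by
  rw [jacobiTheta₂_term]
  have h1 : cexp (2 * π * I * n * (1 / 2)) = (-1 : ℂ) ^ n := by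
    rw [show 2 * π * I * n * (1 / 2) = n * (π * I) by ring, Complex.exp_int_mul, Complex.exp_pi_mul_I]
  have hsq : ((n.natAbs : ℕ) : ℂ) ^ 2 = (n : ℂ) ^ 2 := by
    rcases Int.natAbs_eq n with h | h
    · conv_rhs => rw [h]
      simp
    · conv_rhs => rw [h]
      simp
  have h2 : cexp (π * I * n ^ 2 * (2 * (t : ℂ) * τ)) = Function.Periodic.qParam 1 τ ^ (t * n.natAbs ^ 2) := by
    rw [Function.Periodic.qParam, ← Complex.exp_nat_mul]
    congr 1
    push_cast
    rw [hsq]; ring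
  rw [Complex.exp_add, h1, h2]

/-- **The integer `q`-series of `ϑ₄(2tτ)`** (`t ≥ 1`): `∃ c : ℕ → ℤ`, `Σₘ cₘ 𝕢τᵐ = ϑ₄(2tτ)` on `ℍ`. [cite: WhittakerWatson1927, §21.1] -/
theorem exists_hasSum_theta4_two_mul (t : ℕ) (ht : 0 < t) :
    ∃ c : ℕ → ℤ, ∀ τ : ℍ, HasSum (fun m : ℕ ↦ (c m : ℂ) * Function.Periodic.qParam 1 (τ : ℂ) ^ m) (theta4 (2 * (t : ℂ) * τ)) := by
  classical
  -- the coefficients: `c (t n²) = 2(−1)ⁿ` for `n ≥ 1`, `c 0 = 1`, `0` otherwise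
  refine ⟨fun m ↦ if m = 0 then 1 else if ∃ n : ℕ, t * n ^ 2 = m then 2 * (-1) ^ Nat.sqrt (m / t) else 0, fun τ ↦ ?_⟩
  set q : ℂ := Function.Periodic.qParam 1 (τ : ℂ) with hq
  have hτ2 : 0 < (2 * (t : ℂ) * τ).im := by
    have : (2 * (t : ℂ) * τ).im = 2 * t * τ.im := by simp [mul_assoc]
    rw [this]; exact mul_pos (mul_pos two_pos (by exact_mod_cast ht)) τ.im_pos
  -- the `ℤ`-indexed series and its folding over `±n`
  have hZ : HasSum (fun n : ℤ ↦ (-1 : ℂ) ^ n * q ^ (t * n.natAbs ^ 2)) (theta4 (2 * (t : ℂ) * τ)) := by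
    have h := hasSum_jacobiTheta₂_term (1 / 2) hτ2
    simp only [jacobiTheta₂_term_half_two_mul] at h
    exact h
  have hN := hZ.nat_add_neg
  simp only [zpow_natCast, Int.natAbs_neg, Int.natAbs_natCast, zpow_neg, zpow_zero, Int.natAbs_zero, one_mul] at hN
  -- `(−1)^{-n} = (−1)^n`, so the folded term is `2(−1)ⁿ q^{t n²}`
  have hN' : HasSum (fun n : ℕ ↦ 2 * (-1 : ℂ) ^ n * q ^ (t * n ^ 2)) (theta4 (2 * (t : ℂ) * τ) + q ^ (t * 0 ^ 2)) := by
    convert hN using 2 with n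
    have : ((-1 : ℂ) ^ n)⁻¹ = (-1 : ℂ) ^ n := by rw [← inv_pow, inv_neg, inv_one]
    rw [this]; ring
  simp only [ne_eq, OfNat.ofNat_ne_zero, not_false_eq_true, zero_pow, mul_zero, pow_zero] at hN'
  -- subtract the doubled `n = 0` term: the series `F ∘ (n ↦ t n²)`
  set F : ℕ → ℂ := fun m ↦ ((if m = 0 then 1 else if ∃ n : ℕ, t * n ^ 2 = m then 2 * (-1) ^ Nat.sqrt (m / t) else 0 : ℤ) : ℂ) * q ^ m
    with hF
  have hinj : Function.Injective (fun n : ℕ ↦ t * n ^ 2) := by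
    intro a b hab
    have h := Nat.eq_of_mul_eq_mul_left ht hab
    exact (Nat.pow_left_injective two_ne_zero) h
  have hcomp : (F ∘ fun n : ℕ ↦ t * n ^ 2) = fun n : ℕ ↦ 2 * (-1 : ℂ) ^ n * q ^ (t * n ^ 2) - (if n = 0 then 1 else 0) := by
    funext n
    simp only [Function.comp_apply, hF]
    rcases Nat.eq_zero_or_pos n with rfl | hn
    · norm_num
    · have hne : t * n ^ 2 ≠ 0 := by positivity
      have hex : ∃ k : ℕ, t * k ^ 2 = t * n ^ 2 := ⟨n, rfl⟩
      have hsqrt : Nat.sqrt (t * n ^ 2 / t) = n := by rw [Nat.mul_div_cancel_left _ ht, Nat.sqrt_eq']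
      rw [if_neg hne, if_pos hex, hsqrt, if_neg hn.ne']
      push_cast; ring
  have hsub : HasSum (fun n : ℕ ↦ 2 * (-1 : ℂ) ^ n * q ^ (t * n ^ 2) - (if n = 0 then 1 else 0)) (theta4 (2 * (t : ℂ) * τ) + 1 - 1) :=
    hN'.sub (hasSum_ite_eq 0 (1 : ℂ))
  rw [add_sub_cancel_right] at hsub
  rw [← hcomp] at hsub
  have hzero : ∀ m ∉ Set.range (fun n : ℕ ↦ t * n ^ 2), F m = 0 := by
    intro m hm
    simp only [Set.mem_range, not_exists] at hm
    have hm0 : m ≠ 0 := fun h ↦ hm 0 (by simp [h])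
    have hnex : ¬ ∃ n : ℕ, t * n ^ 2 = m := fun ⟨n, hn⟩ ↦ hm n hn
    simp only [hF, if_neg hm0, if_neg hnex, Int.cast_zero, zero_mul]
  exact (hinj.hasSum_iff hzero).mp hsub

end Summit.BirchSwinnertonDyer.BirchSwinnertonDyer.Theorems.ManinLocalTwoThree.EtaAnchor

end
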